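import Summits.QuantumFields.YangMills.Theorems.BalabanUVNodesN08AlphaProfileRecord
import Summits.QuantumFields.Balaban3D.Carriers.Group

/-!
# Route «BalabanUVNodes», Track-A DAG node N08 = [Balaban1985UV3] — (α) clause: the direction hypothesis `X ∈ 𝔤 ∖ 0` DISCHARGED for `SU(N)`, `N ≥ 2`

Cell `pub-ymgap`, seat `pub-ymgap-dag-n08-d` gen 5, file F10 (over F9 `…ProfileRecord` and p1's `Carriers.Group.suGroupModel`).  `bears_on: R4∕N08`; filed
`--supports stmt-QuantumFields-19910 --as helper`.  Sorry-free, standard axioms.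

F8∕F9 leave TWO structural conditions on the in-edge side of the (α) clause: a direction `X ∈ 𝔤 ∖ 0` and `4π ≤ min C68 (2L²B₃)`.  The first is NECESSARY in
general (a finite subgroup of `U(N)` is a group as printed with `𝔤 = ⊥`, and then no regular h-large profile exists) and HOLDS for the groups of interest:
* §1 `suDir hN ∈ 𝔰𝔲(N)`, `suDir hN ≠ 0` (`E₀₁ − E₁₀`, `N ≥ 2`); `exists_ne_zero_mem_lie_su`.
* §2 ★★ `exists_externalInputs_b10_main_family_su` ∕ ★★ `b10_main_at_record_of_dataPin_su` — F8's family theorem and F9's record-predicate closer for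
  `G = SU(N)`, `N ≥ 2` (`Carriers.Group.suGroupModel N`), whose ONLY structural condition is `4π ≤ min C68 (2L²B₃)` on the record.
HONEST FRAMING: the DATA schema (`RunDataRows` = the cluster expansion of [B10]∕[8]–[10]) stays DISPLAYED — the object gap of N08; count-neutral; NOT a
discharge of N08.  d = 3 on finite tori as printed; nothing about d = 4, the continuum, OS axioms, a mass gap or Clay.
-/

noncomputable section

namespace Summit.QuantumFields.YangMills.Theorems.BalabanUVNodesN08AlphaProfileGroupSU

open MeasureTheory Set
open scoped Matrix
open Literature.MathematicalPhysics.QuantumFieldTheory.Balaban1983to89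
open Literature.MathematicalPhysics.QuantumFieldTheory.Balaban1983to89.B10SectCExpansion (TermSizes)
open Literature.MathematicalPhysics.QuantumFieldTheory.Balaban1985CMP102
open Literature.MathematicalPhysics.QuantumFieldTheory.Balaban1985CMP102.Setting
open Literature.MathematicalPhysics.QuantumFieldTheory.Balaban1983to89.DagBinding (leavesP WorldP PrintedCarriersR PrintedCarriers9X
  PrintedCarriers11 PrintedCarriers14R PrintedCarriers15)
open Literature.MathematicalPhysics.QuantumFieldTheory.Balaban1983to89.B10CompactBinding (ofPrintedAllXPNC)
open Literature.Algebra.Lie (CompactKillingForm.mem_su_iff)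
open Summit.QuantumFields.Balaban3D.Carriers
open Summit.QuantumFields.Balaban3D.Proofs.Inputs
open Summit.QuantumFields.Balaban3D.Proofs.Primitives (AlphaConsts)
open Summit.QuantumFields.Balaban3D.Proofs.GroupModelLieC (lieC)
open Summit.QuantumFields.Balaban3D.Proofs.UVStability3DInputs
open Summit.QuantumFields.Balaban3D.Proofs.FamilyLE (ScalesLE)
open Summit.QuantumFields.YangMills.Theorems.BalabanUVNodesN08AlphaClassI
open Summit.QuantumFields.YangMills.Theorems.BalabanUVNodesN08AlphaLoop28
open Summit.QuantumFields.YangMills.Theorems.BalabanUVNodesN08AlphaThreeFaces (regMin)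
open Summit.QuantumFields.YangMills.Theorems.BalabanUVNodesN08AlphaProfileThreshold
open Summit.QuantumFields.YangMills.Theorems.BalabanUVNodesN08AlphaProfileRecord

/-! ## §1 A non-zero direction in `𝔰𝔲(N)`, `N ≥ 2` -/

section Dir

variable {N : ℕ} (hN : 2 ≤ N)

/-- `E₀₁ − E₁₀ ∈ M_N(ℂ)` (`N ≥ 2`): a real antisymmetric traceless matrix. [folklore] -/
def suDir : Matrix (Fin N) (Fin N) ℂ :=
  Matrix.of fun i j => if i = ⟨0, by omega⟩ ∧ j = ⟨1, by omega⟩ then 1 else if i = ⟨1, by omega⟩ ∧ j = ⟨0, by omega⟩ then -1 else 0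

/-- `suDir ∈ 𝔰𝔲(N)` (`Xᴴ = −X`, `Tr X = 0`). [folklore] -/
theorem suDir_mem_su : suDir hN ∈ Literature.Algebra.Lie.CompactKillingForm.su (Fin N) := by
  rw [CompactKillingForm.mem_su_iff]
  have h01 : (⟨0, by omega⟩ : Fin N) ≠ ⟨1, by omega⟩ := by simp
  constructor
  · ext i j
    simp only [suDir, Matrix.conjTranspose_apply, Matrix.of_apply, Matrix.neg_apply]
    by_cases ha : i = ⟨0, by omega⟩ ∧ j = ⟨1, by omega⟩
    · obtain ⟨rfl, rfl⟩ := ha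
      simp [h01, h01.symm]
    · by_cases hb : i = ⟨1, by omega⟩ ∧ j = ⟨0, by omega⟩
      · obtain ⟨rfl, rfl⟩ := hb
        simp [h01, h01.symm]
      · have ha' : ¬(j = ⟨1, by omega⟩ ∧ i = ⟨0, by omega⟩) := fun h => ha ⟨h.2, h.1⟩
        have hb' : ¬(j = ⟨0, by omega⟩ ∧ i = ⟨1, by omega⟩) := fun h => hb ⟨h.2, h.1⟩
        rw [if_neg ha, if_neg hb, if_neg hb', if_neg ha']
        simp
  · unfold Matrix.trace
    refine Finset.sum_eq_zero fun i _ => ?_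
    simp only [Matrix.diag_apply, suDir, Matrix.of_apply]
    have h1 : ¬(i = ⟨0, by omega⟩ ∧ i = ⟨1, by omega⟩) := fun h => h01 (h.1.symm.trans h.2)
    have h2 : ¬(i = ⟨1, by omega⟩ ∧ i = ⟨0, by omega⟩) := fun h => h01 (h.2.symm.trans h.1)
    rw [if_neg h1, if_neg h2]

/-- `suDir ≠ 0` (its `(0,1)` entry is `1`). [folklore] -/
theorem suDir_ne_zero : suDir hN ≠ 0 := by
  intro h
  have := congrFun (congrFun h ⟨0, by omega⟩) ⟨1, by omega⟩
  simp [suDir, Matrix.of_apply] at this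

/-- **`𝔰𝔲(N) ≠ 0` for `N ≥ 2`**: the Lie algebra of the group as printed `suGroupModel N` has a non-zero element. [folklore] -/
theorem exists_ne_zero_mem_lie_su [NeZero N] (hN : 2 ≤ N) : ∃ X ∈ (suGroupModel N).lie, X ≠ 0 :=
  ⟨suDir hN, suDir_mem_su hN, suDir_ne_zero hN⟩

end Dir

/-! ## §2 F8's family theorem and F9's record closer for `SU(N)`, `N ≥ 2`: the only structural condition is `4π ≤ min C68 (2L²B₃)` -/

section SU

variable {L N : ℕ} [NeZero N]

/-- **★★ N08 BY NAME OVER THE CONSTRUCTED RUNS FOR `SU(N)`, `N ≥ 2`, FROM THE DATA SCHEMA AND `4π ≤ min C68 (2L²B₃)` ALONE** (F8's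
`exists_externalInputs_b10_main_family_of_threshold` at `𝔊 := suGroupModel N`, direction `suDir`).
[cite: Balaban1985UV3, Thm 1 p.257 (compact reading) + Thm 2 p.272 + (41)–(42) p.266 + (67)–(68) p.273; Balaban1985Variational, Thm 1 p.279; Balaban1985Averaging, Prop. 2 (54) p.26] -/
theorem exists_externalInputs_b10_main_family_su (hN : 2 ≤ N) (𝔠 : AlphaConsts L (suGroupModel N).N) (X₀ : ∀ S : Scales L, ExternalInputs S (Matrix.specialUnitaryGroup (Fin N) ℂ))
    (hstd : ∀ S : Scales L, (X₀ S).av = AveragingRT.stdAvg S.P (Matrix.specialUnitaryGroup (Fin N) ℂ)) (w : ℝ) (hC : 4 * Real.pi ≤ (regMin 𝔠).C68)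
    (Bk : ∀ (S : Scales L) (k : ℕ), Hist S.P k → Set (PBond S.P k)) :
    ∃ Xe : ∀ S : Scales L, ExternalInputs S (Matrix.specialUnitaryGroup (Fin N) ℂ),
      (∀ S, (Xe S).av = AveragingRT.stdAvg S.P (Matrix.specialUnitaryGroup (Fin N) ℂ) ∧ (Xe S).reg = (X₀ S).reg) ∧
      (∀ S : Scales L, S.g ^ 2 * S.ε₀ ≤ (min (gammaN08d 𝔠) 1) ^ 2 →
        (∀ (k : ℕ) (h : Hist S.P k), Measurable ((Xe S).UkH k h)) ∧ InEdgeFaces₃ (suGroupModel N) (regMin 𝔠) (Xe S) ∧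
        ∀ (𝔖 : ∀ k, StepSeries S (Matrix.specialUnitaryGroup (Fin N) ℂ) ↥(lieC (suGroupModel N)) (nblkOf S 𝔠.lane.carrier k) k) (𝔄 : AlphaData (suGroupModel N) 𝔠 (Xe S) 𝔖)
          (coef : (k : ℕ) → Hist S.P (k + 1) → GaugeField S.P (k + 1) (Matrix.specialUnitaryGroup (Fin N) ℂ) → (j : ℕ) → TermSizes (oldGeom S.P k j)),
          RunDataRows (suGroupModel N) 𝔠 (Xe S) 𝔖 𝔄 (sizesOf (suGroupModel N) 𝔠 (Xe S) coef) → RunAlpha (suGroupModel N) 𝔠 (Xe S) 𝔖 𝔄) ∧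
      ∀ (𝔖 : ∀ (S : Scales L) (k : ℕ), StepSeries S (Matrix.specialUnitaryGroup (Fin N) ℂ) ↥(lieC (suGroupModel N)) (nblkOf S 𝔠.lane.carrier k) k)
        (𝔄 : ∀ S : Scales L, AlphaData (suGroupModel N) 𝔠 (Xe S) (𝔖 S))
        (coef : ∀ (S : Scales L) (k : ℕ), Hist S.P (k + 1) → GaugeField S.P (k + 1) (Matrix.specialUnitaryGroup (Fin N) ℂ) → (j : ℕ) → TermSizes (oldGeom S.P k j))
        (Xc : PrintedCarriersR) (Y : PrintedCarriers9X) (Z : PrintedCarriers11) (V : PrintedCarriers14R) (W : PrintedCarriers15)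
        (w' : WorldP) (P : B12.RunParams),
        (∀ S : Scales L, S.g ^ 2 * S.ε₀ ≤ (min (gammaN08d 𝔠) 1) ^ 2 →
          RunDataRows (suGroupModel N) 𝔠 (Xe S) (𝔖 S) (𝔄 S) (sizesOf (suGroupModel N) 𝔠 (Xe S) (coef S))) →
        w'.up P = ofPrintedAllXPNC (Xc.withTowerRuns10 fun S : ScalesLE L ((min (gammaN08d 𝔠) 1) ^ 2) =>
          towerOf 𝔠.lane (Xe S.1) (𝔖 S.1)) Y Z V W →
        Dag.B10_main (leavesP w' P) :=
  exists_externalInputs_b10_main_family_of_threshold (suGroupModel N) 𝔠 X₀ hstd w (suDir_mem_su hN) (suDir_ne_zero hN) hC Bk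

/-- **★★ RECORD-PREDICATE CLOSER FOR `SU(N)`, `N ≥ 2`, WITH THE DISPLAYED CLAUSE «DATA SCHEMA on `XeOf`» AND THE ONE CONDITION `4π ≤ min C68 (2L²B₃)`**
(F9's `b10_main_at_record_of_dataPin` at `𝔊 := suGroupModel N`, direction `suDir`). [cite: Balaban1985UV3, Thm 1 p.257 (compact reading) + Thm 2 p.272 (bookkeeping shape)] -/
theorem b10_main_at_record_of_dataPin_su (hN : 2 ≤ N) (Rec : WorldP → Prop)
    (hpin : ∀ w', Rec w' → ∀ P : B12.RunParams,
      ∃ (𝔠 : AlphaConsts L (suGroupModel N).N) (hC : 4 * Real.pi ≤ (regMin 𝔠).C68)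
        (X₀ : ∀ S : Scales L, ExternalInputs S (Matrix.specialUnitaryGroup (Fin N) ℂ))
        (hstd : ∀ S : Scales L, (X₀ S).av = AveragingRT.stdAvg S.P (Matrix.specialUnitaryGroup (Fin N) ℂ)) (w : ℝ)
        (Bk : ∀ (S : Scales L) (k : ℕ), Hist S.P k → Set (PBond S.P k))
        (𝔖 : ∀ (S : Scales L) (k : ℕ), StepSeries S (Matrix.specialUnitaryGroup (Fin N) ℂ) ↥(lieC (suGroupModel N)) (nblkOf S 𝔠.lane.carrier k) k)
        (𝔄 : ∀ S : Scales L, AlphaData (suGroupModel N) 𝔠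
          (XeOf (suGroupModel N) 𝔠 X₀ hstd w (suDir_mem_su hN) (suDir_ne_zero hN) hC Bk S) (𝔖 S))
        (coef : ∀ (S : Scales L) (k : ℕ), Hist S.P (k + 1) → GaugeField S.P (k + 1) (Matrix.specialUnitaryGroup (Fin N) ℂ) → (j : ℕ) → TermSizes (oldGeom S.P k j))
        (Xc : PrintedCarriersR) (Y : PrintedCarriers9X) (Z : PrintedCarriers11) (V : PrintedCarriers14R) (W : PrintedCarriers15),
        (∀ S : Scales L, S.g ^ 2 * S.ε₀ ≤ (min (gammaN08d 𝔠) 1) ^ 2 →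
            RunDataRows (suGroupModel N) 𝔠 (XeOf (suGroupModel N) 𝔠 X₀ hstd w (suDir_mem_su hN) (suDir_ne_zero hN) hC Bk S) (𝔖 S) (𝔄 S)
              (sizesOf (suGroupModel N) 𝔠 (XeOf (suGroupModel N) 𝔠 X₀ hstd w (suDir_mem_su hN) (suDir_ne_zero hN) hC Bk S) (coef S))) ∧
          w'.up P = ofPrintedAllXPNC (Xc.withTowerRuns10 fun S : ScalesLE L ((min (gammaN08d 𝔠) 1) ^ 2) =>
            towerOf 𝔠.lane (XeOf (suGroupModel N) 𝔠 X₀ hstd w (suDir_mem_su hN) (suDir_ne_zero hN) hC Bk S.1) (𝔖 S.1)) Y Z V W) :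
    ∀ w', Rec w' → ∀ P, Dag.B10_main (leavesP w' P) := by
  refine b10_main_at_record_of_dataPin (L := L) (suGroupModel N) Rec fun w' hw' P => ?_
  obtain ⟨𝔠, hC, X₀, hstd, w, Bk, 𝔖, 𝔄, coef, Xc, Y, Z, V, W, hD, hup⟩ := hpin w' hw' P
  exact ⟨𝔠, hC, suDir hN, suDir_mem_su hN, suDir_ne_zero hN, X₀, hstd, w, Bk, 𝔖, 𝔄, coef, Xc, Y, Z, V, W, hD, hup⟩

end SU

end Summit.QuantumFields.YangMills.Theorems.BalabanUVNodesN08AlphaProfileGroupSU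

end
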